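import Summits.QuantumFields.BalabanUV.Beta.EriceFlowEnclosureBorelTransformPieces

/-!
# Beta / EriceFlowEnclosureBorelTransformSmooth — THE BOREL TRANSFORM IS `C^∞` ON `(0,∞)` WITH GEVREY-CONTROLLED DERIVATIVES:
# under the uniform Gevrey-1 remainders of `G` on the half-plane `Re w > c₀` (the Borel-DISC hypothesis), the Bromwich integral
# `J[G](t) = ∫_ℝ e^{t(c+is)}G(c+is)ds` (`c > c₀`) satisfies, for every `k` and every `t > 0`,
# `J[G]^{(k)}(t) = 2π·(a_k·[k ≥ 1] + a_{k+1}t)-shaped polynomial part + ∫_ℝ e^{t(c+is)}(c+is)^k R_{k+2}(c+is)ds` and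
# `‖J[G]^{(k)}(t)‖ ≤ 2π·C·K^k·k!·(1 + (k+1)Kt) + π·e^{ct}·C·K^{k+2}(k+2)!∕c²` — Nevanlinna's estimate, the source of the STRIP of
# width `1∕K` (bflow-p3 gen 39, exploratory MODULE 36c over 36a ∕ 36b; Mathlib + tree only)

HONEST FRAMING (page 1 of everything the β sub-cell writes): discharging `BetaPertH` makes Bałaban's UV stability UNCONDITIONAL — a
real constructive-QFT result; it is NOT the continuum limit and NOT the Clay problem.  HONEST DEPENDENCY (cell reorg 2026-08-19,
verbatim): «continuum YM on T⁴ ⇐ BetaPertH ∧ nine spine estimates (0/9 proved); BetaPertH ⇐ (D1) ∧ (D4) ∧ CAP+tail; G-an2-4 gates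
asym, D1 and NE2/3/4.»  THIS MODULE DISCHARGES NOTHING: [folklore] one-variable analysis over Mathlib (no β-function, no flow, no
Erice sentence is used).

SOURCE (shapes only).  [Rivasseau1991] Thm I.5.1 pp. 55–56; [LodayRichaud2016] Thm 5.3.9 (ii)⇒(i) pp. 158–163 (Nevanlinna).

WHAT THIS FILE PROVES (0 sorry, 0 def).  §1 `iteratedDeriv_ofReal_pow`, `contDiff_ofReal_pow_div`, `iteratedDeriv_borelPoly`,
`norm_iteratedDeriv_borelPoly_le`.  §2 HEADLINE **`iteratedDeriv_lineTransform`** and **`norm_iteratedDeriv_lineTransform_le`**,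
`contDiffAt_lineTransform` (the Bromwich integral is `C^∞` on `(0,∞)`), `poly_le`, **`norm_iteratedDeriv_lineTransform_le'`** (the compact
form `‖J^{(k)}(t)‖ ≤ 2πC·K^k k!·(k+1)(k+2)·(1 + Kt + e^{ct}K²∕(2c²))`).
-/

namespace Summit.QuantumFields.BalabanUV.Beta.EriceFlowEnclosureBorelTransformSmooth

open Set Filter Topology MeasureTheory Metric Complex
open scoped Real Nat
open Summit.QuantumFields.BalabanUV.Beta.EriceFlowEnclosureBorelTransform (integrable_inv_sq_add_sq)
open Summit.QuantumFields.BalabanUV.Beta.EriceFlowEnclosureBorelTransformDeriv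
open Summit.QuantumFields.BalabanUV.Beta.EriceFlowEnclosureBorelTransformPieces

noncomputable section

/-! ## §1 Derivatives of the Borel polynomials `Σ a_n tⁿ∕n!` (real variable, complex values) -/

/-- `d^j∕dt^j (t ↦ (t : ℂ)^n) = n(n−1)⋯(n−j+1)·t^{n−j}`. [folklore] -/
theorem iteratedDeriv_ofReal_pow (j n : ℕ) :
    iteratedDeriv j (fun t : ℝ => (t : ℂ) ^ n) = fun t : ℝ => (n.descFactorial j : ℂ) * (t : ℂ) ^ (n - j) := by
  induction j with
  | zero => funext t; simp
  | succ j ih =>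
    rw [iteratedDeriv_succ, ih]
    funext t
    have h : HasDerivAt (fun t : ℝ => (n.descFactorial j : ℂ) * (t : ℂ) ^ (n - j))
        ((n.descFactorial j : ℂ) * (((n - j : ℕ) : ℂ) * (t : ℂ) ^ (n - j - 1))) t := by
      have h1 : HasDerivAt (fun z : ℂ => z ^ (n - j)) (((n - j : ℕ) : ℂ) * (t : ℂ) ^ (n - j - 1)) (t : ℂ) := by
        simpa using hasDerivAt_pow (n - j) (t : ℂ)
      exact (h1.comp_ofReal).const_mul _
    rw [h.deriv, Nat.descFactorial_succ, show n - (j + 1) = n - j - 1 by omega]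
    push_cast
    ring

/-- `t ↦ (t : ℂ)^n∕n!` is smooth. [folklore] -/
theorem contDiff_ofReal_pow_div (n : ℕ) {m : ℕ∞} : ContDiff ℝ m (fun t : ℝ => (t : ℂ) ^ n / (n ! : ℂ)) :=
  (Complex.ofRealCLM.contDiff.pow n).div_const _

/-- **Derivatives of a Borel polynomial**: `d^k∕dt^k Σ_{n∈S} a_n tⁿ∕n! = Σ_{n∈S} a_n·n(n−1)⋯(n−k+1)·t^{n−k}∕n!`. [folklore] -/
theorem iteratedDeriv_borelPoly (a : ℕ → ℂ) (S : Finset ℕ) (k : ℕ) (t : ℝ) :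
    iteratedDeriv k (fun t : ℝ => ∑ n ∈ S, a n * ((t : ℂ) ^ n / (n ! : ℂ))) t =
      ∑ n ∈ S, a n * ((n.descFactorial k : ℂ) * (t : ℂ) ^ (n - k) / (n ! : ℂ)) := by
  have hpow : ∀ n : ℕ, ContDiff ℝ k (fun t : ℝ => (t : ℂ) ^ n) := fun n => Complex.ofRealCLM.contDiff.pow n
  rw [iteratedDeriv_fun_sum fun n _ => (contDiff_const.mul (contDiff_ofReal_pow_div n)).contDiffAt]
  refine Finset.sum_congr rfl fun n _ => ?_
  rw [iteratedDeriv_const_mul (a n) (contDiff_ofReal_pow_div n).contDiffAt]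
  congr 1
  have e : (fun t : ℝ => (t : ℂ) ^ n / (n ! : ℂ)) = fun t : ℝ => ((n ! : ℂ))⁻¹ * (t : ℂ) ^ n := by
    funext t; rw [div_eq_inv_mul]
  rw [e, iteratedDeriv_const_mul _ (hpow n).contDiffAt, iteratedDeriv_ofReal_pow]
  ring

/-- **The `k`-th derivative of the Borel polynomial of degree `k+1`** is bounded by `‖a_k‖ + ‖a_{k+1}‖·t` (`t ≥ 0`; the monomials
of degree `< k` die, `tᵏ∕k!` gives `1`, `t^{k+1}∕(k+1)!` gives `t`). [folklore] -/
theorem norm_iteratedDeriv_borelPoly_le (a : ℕ → ℂ) (k : ℕ) {t : ℝ} (ht : 0 ≤ t) :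
    ‖iteratedDeriv k (fun t : ℝ => ∑ n ∈ Finset.Ico 1 (k + 2), a n * ((t : ℂ) ^ n / (n ! : ℂ))) t‖ ≤
      ‖a k‖ + ‖a (k + 1)‖ * t := by
  rw [iteratedDeriv_borelPoly]
  -- each term in norm
  set f : ℕ → ℝ := fun n => ‖a n‖ * ((n.descFactorial k : ℝ) * t ^ (n - k) / (n ! : ℝ)) with hf
  have hterm : ∀ n : ℕ, ‖a n * ((n.descFactorial k : ℂ) * (t : ℂ) ^ (n - k) / (n ! : ℂ))‖ = f n := by
    intro n
    rw [hf, norm_mul, norm_div, norm_mul, Complex.norm_natCast, Complex.norm_pow, Complex.norm_real,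
      Real.norm_of_nonneg ht, Complex.norm_natCast]
  have hf0 : ∀ n : ℕ, 0 ≤ f n := fun n => by rw [hf]; positivity
  have hflt : ∀ n : ℕ, n < k → f n = 0 := fun n hn => by
    simp only [hf, Nat.descFactorial_eq_zero_iff_lt.mpr hn, Nat.cast_zero, zero_mul, zero_div, mul_zero]
  have hfk : f k = ‖a k‖ := by
    simp only [hf, Nat.descFactorial_self, Nat.sub_self, pow_zero, mul_one]
    have : (k ! : ℝ) ≠ 0 := by exact_mod_cast Nat.factorial_ne_zero k
    field_simp
  have hfk1 : f (k + 1) = ‖a (k + 1)‖ * t := by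
    have e : ((k + 1).descFactorial k : ℝ) = ((k + 1) ! : ℝ) := by
      have := Nat.factorial_mul_descFactorial (Nat.le_succ k)
      rw [show k + 1 - k = 1 by omega, Nat.factorial_one, one_mul] at this
      exact_mod_cast this
    simp only [hf, show k + 1 - k = 1 by omega, pow_one, e]
    have : ((k + 1) ! : ℝ) ≠ 0 := by exact_mod_cast Nat.factorial_ne_zero (k + 1)
    field_simp
  calc ‖∑ n ∈ Finset.Ico 1 (k + 2), a n * ((n.descFactorial k : ℂ) * (t : ℂ) ^ (n - k) / (n ! : ℂ))‖
      ≤ ∑ n ∈ Finset.Ico 1 (k + 2), f n := (norm_sum_le _ _).trans (le_of_eq (Finset.sum_congr rfl fun n _ => hterm n))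
    _ ≤ ∑ n ∈ Finset.range (k + 2), f n :=
        Finset.sum_le_sum_of_subset_of_nonneg (fun n hn => Finset.mem_range.mpr (Finset.mem_Ico.mp hn).2)
          fun n _ _ => hf0 n
    _ = (∑ n ∈ Finset.range k, f n) + f k + f (k + 1) := by rw [Finset.sum_range_succ, Finset.sum_range_succ]
    _ = 0 + ‖a k‖ + ‖a (k + 1)‖ * t := by
        rw [Finset.sum_eq_zero fun n hn => hflt n (Finset.mem_range.mp hn), hfk, hfk1]
    _ = ‖a k‖ + ‖a (k + 1)‖ * t := by ring

/-! ## §2 The derivatives of the Borel transform on `(0,∞)` -/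

/-- **THE `k`-TH DERIVATIVE OF THE BROMWICH INTEGRAL.**  `G` holomorphic on `Re w > c₀ > 0` with the uniform Gevrey-1 remainders
`‖G w − Σ_{1≤n<N} a_n∕w^{n+1}‖ ≤ CK^N N!∕‖w‖^{N+1}` for all `N ≥ 1` (`C ≥ 0`, `K ≥ 0`), `c > c₀`, `t > 0` ⟹ for every `k`, with
`R = G − Σ_{1≤n<k+2} a_n∕w^{n+1}`:
`iteratedDeriv k (t ↦ ∫_ℝ e^{t(c+is)}G(c+is)ds) t = 2π·iteratedDeriv k (Σ_{1≤n<k+2} a_n tⁿ∕n!) t + ∫_ℝ e^{t(c+is)}(c+is)^k R(c+is)ds`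
(36b's decomposition on the open set `(0,∞)`, the polynomial smooth, `J[R]` of class `C^k` with `J[R]^{(k)} = J[w^kR]` by 36a).
[cite: LodayRichaud2016, Thm 5.3.9 (ii)⇒(i)] -/
theorem iteratedDeriv_lineTransform {G : ℂ → ℂ} {a : ℕ → ℂ} {c₀ c C K : ℝ} (hc₀ : 0 < c₀) (hc : c₀ < c) (hC : 0 ≤ C)
    (hK : 0 ≤ K) (hG : DifferentiableOn ℂ G {w : ℂ | c₀ < w.re})
    (hrem : ∀ N : ℕ, 1 ≤ N → ∀ w : ℂ, c₀ < w.re →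
      ‖G w - ∑ n ∈ Finset.Ico 1 N, a n * (1 / w ^ (n + 1))‖ ≤ C * K ^ N * N ! / ‖w‖ ^ (N + 1))
    (k : ℕ) {t : ℝ} (ht : 0 < t) :
    iteratedDeriv k (fun t : ℝ => ∫ s : ℝ, cexp ((t : ℂ) * ((c : ℂ) + (s : ℂ) * I)) * G ((c : ℂ) + (s : ℂ) * I)) t =
      2 * π * iteratedDeriv k (fun t : ℝ => ∑ n ∈ Finset.Ico 1 (k + 2), a n * ((t : ℂ) ^ n / (n ! : ℂ))) t +
      ∫ s : ℝ, cexp ((t : ℂ) * ((c : ℂ) + (s : ℂ) * I)) * (((c : ℂ) + (s : ℂ) * I) ^ k *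
        (fun w : ℂ => G w - ∑ n ∈ Finset.Ico 1 (k + 2), a n * (1 / w ^ (n + 1))) ((c : ℂ) + (s : ℂ) * I)) := by
  have hcpos : 0 < c := hc₀.trans hc
  set R : ℂ → ℂ := fun w : ℂ => G w - ∑ n ∈ Finset.Ico 1 (k + 2), a n * (1 / w ^ (n + 1)) with hR
  set p : ℝ → ℂ := fun t : ℝ => ∑ n ∈ Finset.Ico 1 (k + 2), a n * ((t : ℂ) ^ n / (n ! : ℂ)) with hp
  set J : ℝ → ℂ := fun t : ℝ => ∫ s : ℝ, cexp ((t : ℂ) * ((c : ℂ) + (s : ℂ) * I)) * G ((c : ℂ) + (s : ℂ) * I) with hJ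
  set JR : ℝ → ℂ := fun t : ℝ => ∫ s : ℝ, cexp ((t : ℂ) * ((c : ℂ) + (s : ℂ) * I)) * R ((c : ℂ) + (s : ℂ) * I) with hJR
  -- data of the remainder on the line
  have hRc : Continuous fun s : ℝ => R ((c : ℂ) + (s : ℂ) * I) :=
    continuous_remainder_line (a := a) (N := k + 2) hc₀ hc hG
  set M : ℕ → ℝ := fun j => C * K ^ (k + 2) * (k + 2)! / c ^ (k + 2 - 1 - j) with hM
  have hRb : ∀ j : ℕ, j ≤ k + 1 → ∀ s : ℝ, ‖((c : ℂ) + (s : ℂ) * I) ^ j * R ((c : ℂ) + (s : ℂ) * I)‖ ≤ M j / (c ^ 2 + s ^ 2) :=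
    fun j hj s => remainder_line_bound (R := R) hc₀ hc (by positivity) (by omega) (fun w hw => hrem (k + 2) (by omega) w hw) s
  -- the decomposition on `(0,∞)`
  have hEq : EqOn J (fun t => (2 * π : ℂ) * p t + JR t) (Ioi 0) := fun t' ht' =>
    line_decomposition (N := k + 2) hc₀ hc hC hK (by omega) hG (fun w hw => hrem (k + 2) (by omega) w hw) (le_of_lt ht')
  rw [(hEq.iteratedDeriv_of_isOpen isOpen_Ioi k) ht]
  -- smoothness of the two pieces
  have hp_cd : ContDiff ℝ k p := by
    simp only [hp]
    exact ContDiff.sum fun n _ => contDiff_const.mul (contDiff_ofReal_pow_div n)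
  have hJR_cd : ContDiff ℝ k JR := contDiff_line (k := k + 1) hcpos hRc hRb (Nat.lt_succ_self k)
  have h1 : iteratedDeriv k (fun t => (2 * π : ℂ) * p t + JR t) t =
      iteratedDeriv k (fun t => (2 * π : ℂ) * p t) t + iteratedDeriv k JR t :=
    iteratedDeriv_add (contDiffAt_const.mul hp_cd.contDiffAt) hJR_cd.contDiffAt
  rw [h1, iteratedDeriv_const_mul _ hp_cd.contDiffAt]
  congr 1
  have h2 := iteratedDeriv_line (k := k + 1) hcpos hRc hRb (Nat.le_succ k)
  exact congrFun h2 t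

/-- **NEVANLINNA'S ESTIMATE OF THE DERIVATIVES.**  Under the hypotheses of `iteratedDeriv_lineTransform` and `‖a_n‖ ≤ CK^n n!`:
`‖J[G]^{(k)}(t)‖ ≤ 2π·(CK^k k! + CK^{k+1}(k+1)!·t) + π·e^{ct}·CK^{k+2}(k+2)!∕c²` for every `k` and `t > 0` — i.e. for the Borel transform
`b = J∕(2π)`: `‖b^{(k)}(t)‖ ≤ C·K^k·k!·(1 + (k+1)Kt + e^{ct}K²(k+1)(k+2)∕(2c²))`, a Gevrey-1 sequence of Taylor radius `1∕K` at every
`t > 0`. [cite: Rivasseau1991, Thm I.5.1] [cite: LodayRichaud2016, Thm 5.3.9 (ii)⇒(i)] -/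
theorem norm_iteratedDeriv_lineTransform_le {G : ℂ → ℂ} {a : ℕ → ℂ} {c₀ c C K : ℝ} (hc₀ : 0 < c₀) (hc : c₀ < c) (hC : 0 ≤ C)
    (hK : 0 ≤ K) (hG : DifferentiableOn ℂ G {w : ℂ | c₀ < w.re})
    (hrem : ∀ N : ℕ, 1 ≤ N → ∀ w : ℂ, c₀ < w.re →
      ‖G w - ∑ n ∈ Finset.Ico 1 N, a n * (1 / w ^ (n + 1))‖ ≤ C * K ^ N * N ! / ‖w‖ ^ (N + 1))
    (ha : ∀ n : ℕ, ‖a n‖ ≤ C * K ^ n * n !) (k : ℕ) {t : ℝ} (ht : 0 < t) :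
    ‖iteratedDeriv k (fun t : ℝ => ∫ s : ℝ, cexp ((t : ℂ) * ((c : ℂ) + (s : ℂ) * I)) * G ((c : ℂ) + (s : ℂ) * I)) t‖ ≤
      2 * π * (C * K ^ k * k ! + C * K ^ (k + 1) * (k + 1)! * t) +
        Real.exp (c * t) * (C * K ^ (k + 2) * (k + 2)! / c) * π / c := by
  have hcpos : 0 < c := hc₀.trans hc
  rw [iteratedDeriv_lineTransform hc₀ hc hC hK hG hrem k ht]
  set R : ℂ → ℂ := fun w : ℂ => G w - ∑ n ∈ Finset.Ico 1 (k + 2), a n * (1 / w ^ (n + 1)) with hR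
  have hRb : ∀ s : ℝ, ‖((c : ℂ) + (s : ℂ) * I) ^ k * R ((c : ℂ) + (s : ℂ) * I)‖ ≤
      (C * K ^ (k + 2) * (k + 2)! / c ^ (k + 2 - 1 - k)) / (c ^ 2 + s ^ 2) :=
    fun s => remainder_line_bound (R := R) hc₀ hc (by positivity) (by omega) (fun w hw => hrem (k + 2) (by omega) w hw) s
  have hk1 : k + 2 - 1 - k = 1 := by omega
  simp only [hk1, pow_one] at hRb
  have hJ := norm_line_le (H := fun w => w ^ k * R w) hcpos hRb t
  have hP := norm_iteratedDeriv_borelPoly_le a k ht.le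
  have h2π : ‖(2 * π : ℂ)‖ = 2 * π := by
    rw [show (2 * π : ℂ) = ((2 * π : ℝ) : ℂ) by push_cast; ring, Complex.norm_real, Real.norm_of_nonneg (by positivity)]
  calc ‖2 * π * iteratedDeriv k (fun t : ℝ => ∑ n ∈ Finset.Ico 1 (k + 2), a n * ((t : ℂ) ^ n / (n ! : ℂ))) t +
        ∫ s : ℝ, cexp ((t : ℂ) * ((c : ℂ) + (s : ℂ) * I)) * (((c : ℂ) + (s : ℂ) * I) ^ k * R ((c : ℂ) + (s : ℂ) * I))‖
      ≤ ‖2 * π * iteratedDeriv k (fun t : ℝ => ∑ n ∈ Finset.Ico 1 (k + 2), a n * ((t : ℂ) ^ n / (n ! : ℂ))) t‖ +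
        ‖∫ s : ℝ, cexp ((t : ℂ) * ((c : ℂ) + (s : ℂ) * I)) * (((c : ℂ) + (s : ℂ) * I) ^ k * R ((c : ℂ) + (s : ℂ) * I))‖ :=
        norm_add_le _ _
    _ ≤ 2 * π * (‖a k‖ + ‖a (k + 1)‖ * t) + Real.exp (c * t) * (C * K ^ (k + 2) * (k + 2)! / c) * π / c := by
        rw [norm_mul, h2π]
        exact add_le_add (mul_le_mul_of_nonneg_left hP (by positivity)) hJ
    _ ≤ 2 * π * (C * K ^ k * k ! + C * K ^ (k + 1) * (k + 1)! * t) +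
        Real.exp (c * t) * (C * K ^ (k + 2) * (k + 2)! / c) * π / c := by
        gcongr
        · exact ha k
        · exact ha (k + 1)

/-- **The Bromwich integral is `C^∞` on `(0,∞)`**: under the hypotheses of `iteratedDeriv_lineTransform`, `t ↦ ∫_ℝ e^{t(c+is)}G(c+is)ds`
is `ContDiffAt ℝ m` at every `t > 0`, for every `m` (it agrees near `t` with `2π·p_{m+2} + J[R_{m+2}]`, both of class `C^m`). [folklore] -/
theorem contDiffAt_lineTransform {G : ℂ → ℂ} {a : ℕ → ℂ} {c₀ c C K : ℝ} (hc₀ : 0 < c₀) (hc : c₀ < c) (hC : 0 ≤ C)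
    (hK : 0 ≤ K) (hG : DifferentiableOn ℂ G {w : ℂ | c₀ < w.re})
    (hrem : ∀ N : ℕ, 1 ≤ N → ∀ w : ℂ, c₀ < w.re →
      ‖G w - ∑ n ∈ Finset.Ico 1 N, a n * (1 / w ^ (n + 1))‖ ≤ C * K ^ N * N ! / ‖w‖ ^ (N + 1))
    (m : ℕ) {t : ℝ} (ht : 0 < t) :
    ContDiffAt ℝ m (fun t : ℝ => ∫ s : ℝ, cexp ((t : ℂ) * ((c : ℂ) + (s : ℂ) * I)) * G ((c : ℂ) + (s : ℂ) * I)) t := by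
  have hcpos : 0 < c := hc₀.trans hc
  set R : ℂ → ℂ := fun w : ℂ => G w - ∑ n ∈ Finset.Ico 1 (m + 2), a n * (1 / w ^ (n + 1)) with hR
  have hRc : Continuous fun s : ℝ => R ((c : ℂ) + (s : ℂ) * I) :=
    continuous_remainder_line (a := a) (N := m + 2) hc₀ hc hG
  set M : ℕ → ℝ := fun j => C * K ^ (m + 2) * (m + 2)! / c ^ (m + 2 - 1 - j) with hM
  have hRb : ∀ j : ℕ, j ≤ m + 1 → ∀ s : ℝ, ‖((c : ℂ) + (s : ℂ) * I) ^ j * R ((c : ℂ) + (s : ℂ) * I)‖ ≤ M j / (c ^ 2 + s ^ 2) :=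
    fun j hj s => remainder_line_bound (R := R) hc₀ hc (by positivity) (by omega) (fun w hw => hrem (m + 2) (by omega) w hw) s
  have hEq : EqOn (fun t : ℝ => ∫ s : ℝ, cexp ((t : ℂ) * ((c : ℂ) + (s : ℂ) * I)) * G ((c : ℂ) + (s : ℂ) * I))
      (fun t => (2 * π : ℂ) * (∑ n ∈ Finset.Ico 1 (m + 2), a n * ((t : ℂ) ^ n / (n ! : ℂ))) +
        ∫ s : ℝ, cexp ((t : ℂ) * ((c : ℂ) + (s : ℂ) * I)) * R ((c : ℂ) + (s : ℂ) * I)) (Ioi 0) := fun t' ht' =>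
    line_decomposition (N := m + 2) hc₀ hc hC hK (by omega) hG (fun w hw => hrem (m + 2) (by omega) w hw) (le_of_lt ht')
  have hp_cd : ContDiff ℝ m (fun t : ℝ => ∑ n ∈ Finset.Ico 1 (m + 2), a n * ((t : ℂ) ^ n / (n ! : ℂ))) :=
    ContDiff.sum fun n _ => contDiff_const.mul (contDiff_ofReal_pow_div n)
  have hJR_cd : ContDiff ℝ m (fun t : ℝ => ∫ s : ℝ, cexp ((t : ℂ) * ((c : ℂ) + (s : ℂ) * I)) * R ((c : ℂ) + (s : ℂ) * I)) :=
    contDiff_line (k := m + 1) hcpos hRc hRb (Nat.lt_succ_self m)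
  have hsum_cd : ContDiff ℝ m (fun t : ℝ => (2 * π : ℂ) * (∑ n ∈ Finset.Ico 1 (m + 2), a n * ((t : ℂ) ^ n / (n ! : ℂ))) +
      ∫ s : ℝ, cexp ((t : ℂ) * ((c : ℂ) + (s : ℂ) * I)) * R ((c : ℂ) + (s : ℂ) * I)) :=
    ((contDiff_const (c := (2 * π : ℂ))).mul hp_cd).add hJR_cd
  refine (hsum_cd.contDiffAt (x := t)).congr_of_eventuallyEq ?_
  filter_upwards [isOpen_Ioi.mem_nhds ht] with t' ht'
  exact hEq ht'

/-- `(k+1)(k+2) ≤ 6k² + 2`. [folklore] -/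
theorem poly_le (k : ℕ) : ((k : ℝ) + 1) * ((k : ℝ) + 2) ≤ 6 * (k : ℝ) ^ 2 + 2 := by
  rcases Nat.eq_zero_or_pos k with h | h
  · subst h; norm_num
  · have hk : (1 : ℝ) ≤ k := by exact_mod_cast h
    nlinarith

/-- **The compact bound**: under the hypotheses of 36c, `‖J^{(k)}(t)‖ ≤ 2πC·(K^k·k!)·((k+1)(k+2))·L(t)` with
`L(t) = 1 + Kt + e^{ct}K²∕(2c²)`, `t > 0`. [folklore] -/
theorem norm_iteratedDeriv_lineTransform_le' {G : ℂ → ℂ} {a : ℕ → ℂ} {c₀ c C K : ℝ} (hc₀ : 0 < c₀) (hc : c₀ < c)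
    (hC : 0 ≤ C) (hK : 0 ≤ K) (hG : DifferentiableOn ℂ G {w : ℂ | c₀ < w.re})
    (hrem : ∀ N : ℕ, 1 ≤ N → ∀ w : ℂ, c₀ < w.re →
      ‖G w - ∑ n ∈ Finset.Ico 1 N, a n * (1 / w ^ (n + 1))‖ ≤ C * K ^ N * N ! / ‖w‖ ^ (N + 1))
    (ha : ∀ n : ℕ, ‖a n‖ ≤ C * K ^ n * n !) (k : ℕ) {t : ℝ} (ht : 0 < t) :
    ‖iteratedDeriv k (fun t : ℝ => ∫ s : ℝ, cexp ((t : ℂ) * ((c : ℂ) + (s : ℂ) * I)) * G ((c : ℂ) + (s : ℂ) * I)) t‖ ≤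
      2 * π * C * (K ^ k * k !) * (((k : ℝ) + 1) * ((k : ℝ) + 2)) *
        (1 + K * t + Real.exp (c * t) * K ^ 2 / (2 * c ^ 2)) := by
  have hcpos : 0 < c := hc₀.trans hc
  refine (norm_iteratedDeriv_lineTransform_le hc₀ hc hC hK hG hrem ha k ht).trans ?_
  have hfac1 : ((k + 1) ! : ℝ) = ((k : ℝ) + 1) * k ! := by push_cast [Nat.factorial_succ]; ring
  have hfac2 : ((k + 2) ! : ℝ) = ((k : ℝ) + 2) * (((k : ℝ) + 1) * k !) := by
    rw [show k + 2 = (k + 1) + 1 by ring]; push_cast [Nat.factorial_succ]; ring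
  rw [hfac1, hfac2]
  have hk0 : (0 : ℝ) ≤ k := Nat.cast_nonneg k
  have hkf : (0 : ℝ) < k ! := by exact_mod_cast Nat.factorial_pos k
  have hKk : 0 ≤ K ^ k := pow_nonneg hK k
  have he : 0 < Real.exp (c * t) := Real.exp_pos _
  -- termwise comparison
  have h1 : 2 * π * (C * K ^ k * k !) ≤ 2 * π * C * (K ^ k * k !) * (((k : ℝ) + 1) * ((k : ℝ) + 2)) * 1 := by
    have : (1 : ℝ) ≤ ((k : ℝ) + 1) * ((k : ℝ) + 2) := by nlinarith
    nlinarith [mul_nonneg (mul_nonneg (by positivity : (0:ℝ) ≤ 2 * π * C) hKk) hkf.le]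
  have h2 : 2 * π * (C * K ^ (k + 1) * (((k : ℝ) + 1) * k !) * t) ≤
      2 * π * C * (K ^ k * k !) * (((k : ℝ) + 1) * ((k : ℝ) + 2)) * (K * t) := by
    rw [pow_succ]
    have : ((k : ℝ) + 1) ≤ ((k : ℝ) + 1) * ((k : ℝ) + 2) := by nlinarith
    nlinarith [mul_nonneg (mul_nonneg (mul_nonneg (by positivity : (0:ℝ) ≤ 2 * π * C) hKk) hkf.le)
      (mul_nonneg hK ht.le)]
  have h3 : Real.exp (c * t) * (C * K ^ (k + 2) * (((k : ℝ) + 2) * (((k : ℝ) + 1) * k !)) / c) * π / c =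
      2 * π * C * (K ^ k * k !) * (((k : ℝ) + 1) * ((k : ℝ) + 2)) * (Real.exp (c * t) * K ^ 2 / (2 * c ^ 2)) := by
    field_simp
    ring
  calc 2 * π * (C * K ^ k * k ! + C * K ^ (k + 1) * (((k : ℝ) + 1) * k !) * t) +
        Real.exp (c * t) * (C * K ^ (k + 2) * (((k : ℝ) + 2) * (((k : ℝ) + 1) * k !)) / c) * π / c
      = 2 * π * (C * K ^ k * k !) + 2 * π * (C * K ^ (k + 1) * (((k : ℝ) + 1) * k !) * t) +
        Real.exp (c * t) * (C * K ^ (k + 2) * (((k : ℝ) + 2) * (((k : ℝ) + 1) * k !)) / c) * π / c := by ring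
    _ ≤ 2 * π * C * (K ^ k * k !) * (((k : ℝ) + 1) * ((k : ℝ) + 2)) * 1 +
        2 * π * C * (K ^ k * k !) * (((k : ℝ) + 1) * ((k : ℝ) + 2)) * (K * t) +
        2 * π * C * (K ^ k * k !) * (((k : ℝ) + 1) * ((k : ℝ) + 2)) * (Real.exp (c * t) * K ^ 2 / (2 * c ^ 2)) := by
        rw [← h3]; exact add_le_add (add_le_add h1 h2) le_rfl
    _ = _ := by ring


end

end Summit.QuantumFields.BalabanUV.Beta.EriceFlowEnclosureBorelTransformSmooth
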